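import Summits.KontsevichZagierPeriods.Zeta5Search.Barrier.ConeGammaShiftGerms

/-!
# ζ(5) search — BARRIER: the saving along a line changes only on a THIN set (first-moment bound)

HONEST FRAMING (cell `pub-zeta5`): systematic search; no irrationality claim unless kernel-certified. MODEL objects
under Brown–Zudilin's (28)+(30) accounting ([BZ22] = arXiv:2210.03391); nothing here is a statement about `ζ(5)`,
about `γ`, or about the cone's supremum (C2 = `BarrierC2` stays OPEN; the lemma S-E stays CONJECTURED); records in
print UNMOVED. Prover P2 g19 (self-selected Lean-only item of the P2 lineage; sources: P2 g11 `SE-STRUCTURE.md` §3,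
lead/lit g27 `SE-DESK-NOTE.md` §2; builds on the theory seat's (P4) chain `ConeGammaShift*` of cert-2 g17).

Part 1/3 of the kernel LOG-CUSP SHAPE theorem for `Φ = phi30` (`ConeGammaLogCusp`). The one new analytic input,
in the weak form «a form near an integer, or no change» of the desk note's fact (a):

* `torusN_add_eq_of_forms_far` — if every one of the 28 forms of the displacement `Δ` is smaller than the distance
  of the corresponding form of `θ` to `ℤ`, then `𝒩(θ + Δ) = 𝒩(θ)` (form-indexed `torusN_add_smul_of_nonmember`);
* `mem_thinSet_of_near_int`, `volume_real_thinSet_le` — for `x > 0` the set of `s ∈ [0, L]` with `s·x + c` within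
  `η` of an integer is covered by at most `L·x + 2η + 3` intervals of length `2η/x`;
* **`setIntegral_abs_le_of_forms_far`** — a function on `(0, L]` bounded by `B` that vanishes whenever all 28 affine
  forms `s·x_k + c_k` are `η_k`-far from `ℤ` has `∫_{(0,L]} |F| ≤ B·Σ_k (L·x_k + 2η_k + 3)·(2η_k/x_k)`;
* **`setIntegral_abs_torusN_sub_le`**, **`setIntegral_abs_torusN_sub_le_linear`** — hence, along the line
  `s ↦ s·s(a) + c` of a direction with all forms positive, a displacement `Δ(s)` whose forms are bounded by
  `t·|φ_k(δ)|` on `(0, L]` (`t·Y(δ) ≤ 1`) changes `𝒩` only at `L¹((0,L])`-cost `≤ t·392·Y·(L·x_max + 5)/x_min` —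
  LINEAR in the size `t` of the displacement, UNIFORM in the offset `c` (this uniformity is what controls the
  within-period drift at every translate `δ_k`).
Also the elementary sums used in part 3/3: `sum_range_inv_mul_succ` (`Σ_{j<n} 1/((j+1)(j+2)) = 1 − 1/(n+1)`),
`harmonic_cast_eq_sum`, `log_le_harmonic_pred_le` (`log K ≤ H_{K−1} ≤ 1 + log K`), `period_error_le`.
Not here: anything about `Φ` (parts 2/3, 3/3).
-/


noncomputable section

open Set MeasureTheory
open scoped Topology

namespace Summit.KontsevichZagierPeriods.Zeta5Search.Barrier.ConeGamma

/-! ### Pointwise: forms far from the integers ⇒ no change -/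

/-- **Form-indexed non-member lemma**: if `|φ_k(Δ)| < |φ_k(θ) − z|` for every form `k` and every integer `z`, then
`𝒩(θ + Δ) = 𝒩(θ)`. -/
theorem torusN_add_eq_of_forms_far {θ Δ : Fin 8 → ℝ}
    (h : ∀ (k : Fin 28) (z : ℤ), |phiForm Δ k| < |phiForm θ k - z|) : torusN (θ + Δ) = torusN θ := by
  have key := torusN_add_smul_of_nonmember (θ := θ) (δ := Δ) (fun i j hij z => ?_) zero_le_one le_rfl
  · simpa using key
  rcases lt_or_gt_of_ne hij with hlt | hgt
  · rw [pairForm_eq_phiForm_idxOf Δ hlt, pairForm_eq_phiForm_idxOf θ hlt]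
    exact h _ z
  · rw [pairForm_comm Δ, pairForm_comm θ, pairForm_eq_phiForm_idxOf Δ hgt, pairForm_eq_phiForm_idxOf θ hgt]
    exact h _ z

/-! ### The thin set of one affine form -/

/-- **Covering**: for `x > 0`, if `0 ≤ s ≤ L` and `s·x + c` is within `η` of the integer `z`, then `s` lies in the
interval `[(z − c − η)/x, (z − c + η)/x]` and `z ∈ [⌊c − η⌋, ⌈L·x + c + η⌉]`. -/
theorem mem_thinSet_of_near_int {x c η L s : ℝ} (hx : 0 < x) (hs0 : 0 ≤ s) (hsL : s ≤ L) {z : ℤ}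
    (hz : |s * x + c - z| ≤ η) :
    s ∈ ⋃ m ∈ Finset.Icc ⌊c - η⌋ ⌈L * x + c + η⌉, Icc (((m : ℝ) - c - η) / x) (((m : ℝ) - c + η) / x) := by
  obtain ⟨h1, h2⟩ := abs_le.mp hz
  have hsx : 0 ≤ s * x := mul_nonneg hs0 hx.le
  have hsxL : s * x ≤ L * x := mul_le_mul_of_nonneg_right hsL hx.le
  refine Set.mem_iUnion₂.mpr ⟨z, Finset.mem_Icc.mpr ⟨?_, ?_⟩, ?_⟩
  · exact Int.floor_le_iff.mpr (by linarith)
  · exact Int.cast_le.mp ((show (z : ℝ) ≤ L * x + c + η by linarith).trans (Int.le_ceil _))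
  · exact ⟨(div_le_iff₀ hx).mpr (by linarith), (le_div_iff₀ hx).mpr (by linarith)⟩

/-- The number of intervals: `#[⌊c − η⌋, ⌈L·x + c + η⌉] ≤ L·x + 2η + 3` (for `L·x ≥ 0`, `η ≥ 0`). -/
theorem card_thinIdx_le {x c η L : ℝ} (hLx : 0 ≤ L * x) (hη : 0 ≤ η) :
    ((Finset.Icc ⌊c - η⌋ ⌈L * x + c + η⌉).card : ℝ) ≤ L * x + 2 * η + 3 := by
  rw [Int.card_Icc]
  have hle : ⌊c - η⌋ ≤ ⌈L * x + c + η⌉ + 1 := by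
    have h1 : (⌊c - η⌋ : ℝ) ≤ c - η := Int.floor_le _
    have h2 : L * x + c + η ≤ (⌈L * x + c + η⌉ : ℝ) := Int.le_ceil _
    have : (⌊c - η⌋ : ℝ) ≤ (⌈L * x + c + η⌉ : ℝ) + 1 := by linarith
    exact_mod_cast this
  have hnn : 0 ≤ ⌈L * x + c + η⌉ + 1 - ⌊c - η⌋ := by omega
  have hcast : (((⌈L * x + c + η⌉ + 1 - ⌊c - η⌋).toNat : ℕ) : ℝ) = ((⌈L * x + c + η⌉ + 1 - ⌊c - η⌋ : ℤ) : ℝ) := by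
    rw [← Int.toNat_of_nonneg hnn]
    push_cast
    rw [Int.toNat_of_nonneg hnn]
  rw [hcast]
  push_cast
  have h3 : (⌈L * x + c + η⌉ : ℝ) < L * x + c + η + 1 := Int.ceil_lt_add_one _
  have h4 : c - η < (⌊c - η⌋ : ℝ) + 1 := Int.lt_floor_add_one _
  linarith

/-- **Volume of the thin set**: at most `(L·x + 2η + 3)·(2η/x)`. -/
theorem volume_real_thinSet_le {x c η L : ℝ} (hx : 0 < x) (hη : 0 ≤ η) (hL : 0 ≤ L) :
    volume.real (⋃ m ∈ Finset.Icc ⌊c - η⌋ ⌈L * x + c + η⌉, Icc (((m : ℝ) - c - η) / x) (((m : ℝ) - c + η) / x))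
      ≤ (L * x + 2 * η + 3) * (2 * η / x) := by
  refine (measureReal_biUnion_finset_le _ _).trans ?_
  have hlen : ∀ m : ℤ, volume.real (Icc (((m : ℝ) - c - η) / x) (((m : ℝ) - c + η) / x)) = 2 * η / x := by
    intro m
    rw [Real.volume_real_Icc_of_le (by gcongr; linarith)]
    ring
  simp only [hlen, Finset.sum_const, nsmul_eq_mul]
  exact mul_le_mul_of_nonneg_right (card_thinIdx_le (mul_nonneg hL hx.le) hη)
    (div_nonneg (by linarith) hx.le)

/-- The thin set has finite measure. -/
theorem volume_thinSet_ne_top (x c η L : ℝ) :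
    volume (⋃ m ∈ Finset.Icc ⌊c - η⌋ ⌈L * x + c + η⌉, Icc (((m : ℝ) - c - η) / x) (((m : ℝ) - c + η) / x))
      ≠ ⊤ := by
  refine ne_top_of_le_ne_top ?_ (measure_biUnion_finset_le _ _)
  exact (ENNReal.sum_lt_top.mpr fun m _ => measure_Icc_lt_top).ne

/-- The thin set is measurable. -/
theorem measurableSet_thinSet (x c η L : ℝ) :
    MeasurableSet (⋃ m ∈ Finset.Icc ⌊c - η⌋ ⌈L * x + c + η⌉,
      Icc (((m : ℝ) - c - η) / x) (((m : ℝ) - c + η) / x)) :=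
  Finset.measurableSet_biUnion _ fun _ _ => measurableSet_Icc

/-! ### The first-moment bound -/

/-- **A function on `(0, L]` that is bounded by `B` and vanishes whenever all 28 affine forms `s·x_k + c_k` are
`η_k`-far from `ℤ` has small integral**: `∫_{(0,L]} |F| ≤ B·Σ_k (L·x_k + 2η_k + 3)·(2η_k/x_k)`. -/
theorem setIntegral_abs_le_of_forms_far {x c η : Fin 28 → ℝ} (hx : ∀ k, 0 < x k) (hη : ∀ k, 0 ≤ η k)
    {L B : ℝ} (hL : 0 ≤ L) (hB : 0 ≤ B) {F : ℝ → ℝ} (hFB : ∀ s ∈ Ioc 0 L, |F s| ≤ B)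
    (hF0 : ∀ s ∈ Ioc 0 L, (∀ (k : Fin 28) (z : ℤ), η k < |s * x k + c k - z|) → F s = 0) :
    ∫ s in Ioc 0 L, |F s| ≤ B * ∑ k, (L * x k + 2 * η k + 3) * (2 * η k / x k) := by
  -- the union of the 28 thin sets
  set V : Set ℝ := ⋃ k ∈ (Finset.univ : Finset (Fin 28)), ⋃ m ∈ Finset.Icc ⌊c k - η k⌋ ⌈L * x k + c k + η k⌉,
    Icc (((m : ℝ) - c k - η k) / x k) (((m : ℝ) - c k + η k) / x k) with hV
  have hVmeas : MeasurableSet V :=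
    Finset.measurableSet_biUnion _ fun k _ => measurableSet_thinSet (x k) (c k) (η k) L
  have hVfin : volume V ≠ ⊤ := by
    refine ne_top_of_le_ne_top ?_ (measure_biUnion_finset_le _ _)
    exact (ENNReal.sum_lt_top.mpr fun k _ =>
      (volume_thinSet_ne_top (x k) (c k) (η k) L).lt_top).ne
  have hVreal : volume.real V ≤ ∑ k, (L * x k + 2 * η k + 3) * (2 * η k / x k) :=
    (measureReal_biUnion_finset_le _ _).trans
      (Finset.sum_le_sum fun k _ => volume_real_thinSet_le (hx k) (hη k) hL)
  -- pointwise domination by `B · 𝟙_V`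
  have hdom : ∀ s ∈ Ioc 0 L, |F s| ≤ B * V.indicator 1 s := by
    intro s hs
    by_cases hsV : s ∈ V
    · rw [Set.indicator_of_mem hsV]; simpa using hFB s hs
    · rw [hF0 s hs fun k z => ?_]
      · simp [Set.indicator_of_notMem hsV]
      by_contra hcon
      push Not at hcon
      exact hsV (Set.mem_biUnion (Finset.mem_univ k) (mem_thinSet_of_near_int (hx k) hs.1.le hs.2 hcon))
  have hint : Integrable (fun s => B * V.indicator (1 : ℝ → ℝ) s) (volume.restrict (Ioc 0 L)) := by
    refine Integrable.const_mul ?_ B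
    exact ((integrable_indicator_iff hVmeas).mpr
      (integrableOn_const hVfin)).mono_measure Measure.restrict_le_self
  calc ∫ s in Ioc 0 L, |F s| ≤ ∫ s in Ioc 0 L, B * V.indicator 1 s := by
        refine integral_mono_of_nonneg (Filter.Eventually.of_forall fun s => abs_nonneg _) hint ?_
        exact (ae_restrict_iff' measurableSet_Ioc).mpr (Filter.Eventually.of_forall hdom)
    _ = B * ∫ s in Ioc 0 L, V.indicator 1 s := integral_const_mul _ _
    _ ≤ B * ∫ s, V.indicator 1 s := by
        refine mul_le_mul_of_nonneg_left ?_ hB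
        exact setIntegral_le_integral ((integrable_indicator_iff hVmeas).mpr (integrableOn_const hVfin))
          (Filter.Eventually.of_forall fun s => Set.indicator_nonneg (fun _ _ => zero_le_one) _)
    _ = B * volume.real V := by rw [integral_indicator_one hVmeas]
    _ ≤ B * ∑ k, (L * x k + 2 * η k + 3) * (2 * η k / x k) := mul_le_mul_of_nonneg_left hVreal hB

/-- Forms along a displaced line: `φ_k(s·s(a) + c + Δ) = s·h_k(a) + φ_k(c) + φ_k(Δ)`. -/
theorem phiForm_line_add (a : Dir) (c Δ : Fin 8 → ℝ) (s : ℝ) (k : Fin 28) :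
    phiForm (s • sParam a + c + Δ) k = s * h28 a k + phiForm c k + phiForm Δ k := by
  rw [phiForm_add, phiForm_line]

/-- **First-moment bound for `𝒩` along a line**: for a direction with all forms positive, an offset `c` and a
displacement `Δ(s)` whose forms are bounded by `η_k ≥ 0` on `(0, L]`,
`∫_{(0,L]} |𝒩(s·s(a) + c + Δ(s)) − 𝒩(s·s(a) + c)| ds ≤ 7·Σ_k (L·h_k(a) + 2η_k + 3)·(2η_k/h_k(a))`. -/
theorem setIntegral_abs_torusN_sub_le {a : Dir} (hpos : ∀ k, 0 < h28 a k) (c : Fin 8 → ℝ)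
    (Δ : ℝ → Fin 8 → ℝ) {η : Fin 28 → ℝ} (hη : ∀ k, 0 ≤ η k) {L : ℝ} (hL : 0 ≤ L)
    (hΔ : ∀ s ∈ Ioc 0 L, ∀ k, |phiForm (Δ s) k| ≤ η k) :
    ∫ s in Ioc 0 L, |(torusN (s • sParam a + c + Δ s) : ℝ) - torusN (s • sParam a + c)|
      ≤ 7 * ∑ k, (L * h28 a k + 2 * η k + 3) * (2 * η k / h28 a k) := by
  refine setIntegral_abs_le_of_forms_far (c := fun k => phiForm c k) hpos hη hL (by norm_num)
    (fun s _ => ?_) (fun s hs hfar => ?_)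
  · rw [abs_sub_le_iff]
    have h1 : (0 : ℝ) ≤ torusN (s • sParam a + c + Δ s) := by exact_mod_cast torusN_nonneg _
    have h2 : (torusN (s • sParam a + c + Δ s) : ℝ) ≤ 7 := by exact_mod_cast torusN_le_seven _
    have h3 : (0 : ℝ) ≤ torusN (s • sParam a + c) := by exact_mod_cast torusN_nonneg _
    have h4 : (torusN (s • sParam a + c) : ℝ) ≤ 7 := by exact_mod_cast torusN_le_seven _
    constructor <;> linarith
  · rw [sub_eq_zero, Int.cast_inj]
    refine torusN_add_eq_of_forms_far fun k z => ?_
    rw [phiForm_line]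
    exact (hΔ s hs k).trans_lt (hfar k z)


/-! ### Constants: the first-moment bound made linear in the displacement size -/

/-- `φ_k(t·θ) = t·φ_k(θ)`. -/
theorem phiForm_smul (t : ℝ) (θ : Fin 8 → ℝ) (k : Fin 28) : phiForm (t • θ) k = t * phiForm θ k := by
  rw [phiForm_eq, phiForm_eq, pairForm_smul]

/-- `x_min ≤ x_max`. -/
theorem xMin_le_xMax (a : Dir) : xMin a ≤ xMax a := (xMin_le a 0).trans (le_xMax a 0)

/-- One summand of the first-moment bound, when `η_k ≤ t·Y ≤ 1`:
`(L·h_k + 2η_k + 3)·(2η_k/h_k) ≤ (L·x_max + 5)·(2tY/x_min)`. -/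
theorem thin_summand_le {a : Dir} (hpos : ∀ k, 0 < h28 a k) {L t Y η : ℝ} (hL : 0 ≤ L) (ht : 0 ≤ t)
    (hY : 0 ≤ Y) (hη0 : 0 ≤ η) (hηt : η ≤ t * Y) (htY : t * Y ≤ 1) (k : Fin 28) :
    (L * h28 a k + 2 * η + 3) * (2 * η / h28 a k) ≤ (L * xMax a + 5) * (2 * (t * Y) / xMin a) := by
  have hx := hpos k
  have hxmin := xMin_pos hpos
  have h1 : L * h28 a k + 2 * η + 3 ≤ L * xMax a + 5 := by
    have := mul_le_mul_of_nonneg_left (le_xMax a k) hL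
    linarith
  have h2 : 2 * η / h28 a k ≤ 2 * (t * Y) / xMin a := by
    rw [div_le_div_iff₀ hx hxmin]
    have := mul_le_mul hηt (xMin_le a k) hxmin.le (mul_nonneg ht hY)
    linarith
  have h3 : 0 ≤ 2 * η / h28 a k := div_nonneg (by linarith) hx.le
  have h4 : 0 ≤ L * xMax a + 5 := by nlinarith [xMax_pos hpos]
  calc (L * h28 a k + 2 * η + 3) * (2 * η / h28 a k) ≤ (L * xMax a + 5) * (2 * η / h28 a k) :=
        mul_le_mul_of_nonneg_right h1 h3
    _ ≤ (L * xMax a + 5) * (2 * (t * Y) / xMin a) := mul_le_mul_of_nonneg_left h2 h4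

/-- **Linear first-moment bound**: along `s ↦ s·s(a) + c`, a displacement `Δ(s)` whose forms are bounded by
`t·|φ_k(δ)|` on `(0, L]`, with `t·Y(δ) ≤ 1`, costs at most `t · 392·Y·(L·x_max + 5)/x_min` in `L¹((0,L])`. -/
theorem setIntegral_abs_torusN_sub_le_linear {a : Dir} (hpos : ∀ k, 0 < h28 a k) (c : Fin 8 → ℝ)
    (Δ : ℝ → Fin 8 → ℝ) (δ : Fin 8 → ℝ) {L t : ℝ} (hL : 0 ≤ L) (ht : 0 ≤ t) (htY : t * shiftSize δ ≤ 1)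
    (hΔ : ∀ s ∈ Ioc 0 L, ∀ k, |phiForm (Δ s) k| ≤ t * |phiForm δ k|) :
    ∫ s in Ioc 0 L, |(torusN (s • sParam a + c + Δ s) : ℝ) - torusN (s • sParam a + c)|
      ≤ t * (392 * shiftSize δ * (L * xMax a + 5) / xMin a) := by
  have hY := shiftSize_nonneg δ
  refine (setIntegral_abs_torusN_sub_le hpos c Δ (η := fun k => t * |phiForm δ k|)
    (fun k => mul_nonneg ht (abs_nonneg _)) hL hΔ).trans ?_
  have hsum : ∑ k : Fin 28, (L * h28 a k + 2 * (t * |phiForm δ k|) + 3) * (2 * (t * |phiForm δ k|) / h28 a k)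
      ≤ ∑ _k : Fin 28, (L * xMax a + 5) * (2 * (t * shiftSize δ) / xMin a) :=
    Finset.sum_le_sum fun k _ => thin_summand_le hpos hL ht hY (mul_nonneg ht (abs_nonneg _))
      (mul_le_mul_of_nonneg_left (abs_phiForm_le_shiftSize δ k) ht) htY k
  refine (mul_le_mul_of_nonneg_left hsum (by norm_num)).trans ?_
  rw [Finset.sum_const, Finset.card_univ, Fintype.card_fin, nsmul_eq_mul]
  apply le_of_eq
  simp only [div_eq_mul_inv]
  ring


/-! ### Elementary sums and the harmonic–logarithm comparison -/

/-- `Σ_{j<n} 1/((j+1)(j+2)) = 1 − 1/(n+1)`. -/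
theorem sum_range_inv_mul_succ (n : ℕ) :
    ∑ j ∈ Finset.range n, 1 / (((j : ℝ) + 1) * ((j : ℝ) + 2)) = 1 - 1 / ((n : ℝ) + 1) := by
  induction n with
  | zero => simp
  | succ n ih =>
    rw [Finset.sum_range_succ, ih]
    push_cast
    field_simp
    ring

/-- `Σ_{j<n} 1/((j+1)(j+2)) ≤ 1`. -/
theorem sum_range_inv_mul_succ_le_one (n : ℕ) :
    ∑ j ∈ Finset.range n, 1 / (((j : ℝ) + 1) * ((j : ℝ) + 2)) ≤ 1 := by
  rw [sum_range_inv_mul_succ]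
  have : (0 : ℝ) ≤ 1 / ((n : ℝ) + 1) := by positivity
  linarith

/-- The harmonic number as a real sum over `Finset.range`. -/
theorem harmonic_cast_eq_sum (n : ℕ) :
    ((harmonic n : ℚ) : ℝ) = ∑ j ∈ Finset.range n, 1 / ((j : ℝ) + 1) := by
  simp [harmonic, one_div]

/-- **Harmonic vs. logarithm** (`K ≥ 2`): `log K ≤ H_{K−1} ≤ 1 + log K`. -/
theorem log_le_harmonic_pred_le {K : ℕ} (hK : 2 ≤ K) :
    Real.log K ≤ ((harmonic (K - 1) : ℚ) : ℝ) ∧ ((harmonic (K - 1) : ℚ) : ℝ) ≤ 1 + Real.log K := by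
  constructor
  · have h := log_add_one_le_harmonic (K - 1)
    have hc : (K - 1 + 1 : ℕ) = K := by omega
    rwa [hc] at h
  · have h := harmonic_le_one_add_log (K - 1)
    have hmono : Real.log ((K - 1 : ℕ) : ℝ) ≤ Real.log K := by
      apply Real.log_le_log
      · rw [Nat.cast_sub (by omega)]; push_cast
        have : (2 : ℝ) ≤ K := by exact_mod_cast hK
        linarith
      · exact_mod_cast Nat.sub_le K 1
    linarith

/-- The two per-period error terms are dominated by a telescoping sequence:
`εT·C/(kT)² + εkT·C·((kT)⁻² − ((k+1)T)⁻²) ≤ (εC/T)·4/(k(k+1))` (`k ≥ 1`, `C ≥ 0`). -/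
theorem period_error_le {ε T C k : ℝ} (hε : 0 ≤ ε) (hT : 0 < T) (hC : 0 ≤ C) (hk : 1 ≤ k) :
    (1 / (k * T) ^ 2) * ((ε * T) * C) + (1 / (k * T) ^ 2 - 1 / ((k + 1) * T) ^ 2) * ((ε * (k * T)) * C)
      ≤ (ε * C / T) * (4 / (k * (k + 1))) := by
  have hk0 : 0 < k := by linarith
  have e1 : (1 / (k * T) ^ 2) * ((ε * T) * C) = (ε * C / T) * (1 / k ^ 2) := by
    field_simp
  have e2 : (1 / (k * T) ^ 2 - 1 / ((k + 1) * T) ^ 2) * ((ε * (k * T)) * C)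
      = (ε * C / T) * ((2 * k + 1) / (k * (k + 1) ^ 2)) := by
    field_simp
    ring
  have i1 : 1 / k ^ 2 ≤ 2 / (k * (k + 1)) := by
    rw [div_le_div_iff₀ (by positivity) (by positivity)]
    nlinarith
  have i2 : (2 * k + 1) / (k * (k + 1) ^ 2) ≤ 2 / (k * (k + 1)) := by
    rw [div_le_div_iff₀ (by positivity) (by positivity)]
    nlinarith
  rw [e1, e2, ← mul_add]
  refine mul_le_mul_of_nonneg_left ?_ (by positivity)
  have : 2 / (k * (k + 1)) + 2 / (k * (k + 1)) = 4 / (k * (k + 1)) := by ring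
  linarith

end Summit.KontsevichZagierPeriods.Zeta5Search.Barrier.ConeGamma

end
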